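import Summits.QuantumAdvantage.QuantumAdvantage.Theorems.SosSandwichPseudoBoundedAAClassicalCornerSensitivityOSSSPrep
import HarnessLib

/-!
# Crux `PseudoBoundedAA` (stmt-QuantumAdvantage-15237, route SosSandwich) — the SENSITIVITY form of the `L²`-OSSS law on
# the classical corner, part 2/3: the bilinear OSSS inequality by Lee's induction

Support file (`--supports stmt-QuantumAdvantage-15237`), sequel of `…ClassicalCornerSensitivityOSSSPrep.lean`.
`ClassicalCornerQueryOSSS.osss_queries_aux` proves the two-function OSSS inequality with query probabilities for the
tree's `DecisionTree` by Lee's induction relative to a partial assignment `ρ`, bounding the root cross term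
`Σₓ (F₁−F₀)(g₁−g₀)` by `Σₓ |g₁−g₀|` (`|F₁−F₀| ≤ 1`).  Here the cross term is kept BILINEAR (parameter AM–GM
`(F₁−F₀)(g₁−g₀) ≤ (λ/2)(F₁−F₀)² + (g₁−g₀)²/(2λ)`), so the sensitivity of the tree's own output survives:

* **`osss_sens_aux`** — for every partial assignment `ρ`, `0/1` output `F` of `T` on the `ρ`-overridden input, real `g`
  with `Σₓ (g(x^{j→1}) − g(x^{j→0}))² ≤ Sⱼ`, and `λ > 0`:
  `2^N Σ F·g − (Σ F)(Σ g) ≤ ⅛·(λ·2^N·Σⱼ Σₓ (F(x^{j→1}) − F(x^{j→0}))² + (Σⱼ Wⱼ·Sⱼ)/λ)`,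
  `Wⱼ = #{x : ρ j = none ∧ j ∈ T.queries(x̃)}`.
  The partial assignment makes the already-queried coordinates of `g`'s argument play the role of the fresh resampled bits
  of the O'Donnell–Saks–Schramm–Servedio hybrid argument, which is why the GLOBAL squared increments `Sⱼ` (not their
  restrictions to the subcubes) appear; the first sum is `2^N·I[F]` (`F` ignores the coordinates fixed by `ρ`).

The closed form (`ρ = none`) and the mixture corollary `16·Var[p]² ≤ Ī·Σⱼ δ̄ⱼ Infⱼ[p]` are in part 3
(`…ClassicalCornerSensitivityOSSS.lean`).  Honest label: corner calibration (two-function OSSS, bilinear form); no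
registered stub, crux or summit is closed.  Sources: R. O'Donnell, M. Saks, O. Schramm, R. Servedio, FOCS 2005, Thm 3.2;
H. Lee, *Decision trees and influence: an inductive proof of the OSSS inequality*, Theory of Computing 6 (2010) 81–84;
R. O'Donnell, *Analysis of Boolean Functions* (2014) §8.6.
-/

set_option linter.dupNamespace false

noncomputable section

namespace Summit.QuantumAdvantage.QuantumAdvantage.Theorems.SosSandwich

open Finset Function
open Literature.Computability.Complexity Literature.Computability.QuantumComplexity

namespace ClassicalCornerSensitivityOSSS

variable {N : ℕ}
set_option maxHeartbeats 400000 in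
/-- **Bilinear OSSS, inductive version (Lee's induction relative to a partial assignment `ρ`).** For a decision tree `T`
run on the `ρ`-overridden input, with `0/1` output `F`, any real `g` with squared increments
`Σₓ (g(x^{j→1}) − g(x^{j→0}))² ≤ Sⱼ`, and any `λ > 0`:
`2^N Σ F·g − (Σ F)(Σ g) ≤ ⅛·(λ·2^N·Σⱼ Σₓ (F(x^{j→1}) − F(x^{j→0}))² + (Σⱼ Wⱼ·Sⱼ)/λ)`,
`Wⱼ = #{x : ρ j = none ∧ j ∈ T.queries(x̃)}`.  The first sum is `2^N` times the total influence of `F` (coordinates fixed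
by `ρ` contribute nothing since `F` ignores them). [cite: OdonnellEtAl2005, Thm 3.2] [cite: Lee2010, Thm 1 (inductive proof)] -/
theorem osss_sens_aux (T : DecisionTree N) :
    ∀ (ρ : Fin N → Option Bool) (F g : (Fin N → Bool) → ℝ) (S : Fin N → ℝ) (lam : ℝ),
      (∀ x, F x = if T.eval (fun k => (ρ k).getD (x k)) = true then (1 : ℝ) else 0) → (∀ j, 0 ≤ S j) → 0 < lam →
      (∀ j : Fin N, ∑ x, (g (update x j true) - g (update x j false)) ^ 2 ≤ S j) →
      (2 : ℝ) ^ N * (∑ x, F x * g x) - (∑ x, F x) * (∑ x, g x) ≤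
        (lam * (2 : ℝ) ^ N * (∑ j, ∑ x, (F (update x j true) - F (update x j false)) ^ 2) +
          (∑ j, (∑ x : Fin N → Bool,
            (if ρ j = none ∧ j ∈ T.queries (fun k => (ρ k).getD (x k)) then (1 : ℝ) else 0)) * S j) / lam) / 8 := by
  classical
  induction T with
  | leaf c =>
    intro ρ F g S lam hF hS hl hg
    have hc : ∀ x : Fin N → Bool, F x = (if c = true then (1 : ℝ) else 0) := fun x => by
      rw [hF x]; simp [DecisionTree.eval]
    have h1 : ∑ x, F x * g x = (if c = true then (1 : ℝ) else 0) * ∑ x, g x := by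
      rw [Finset.mul_sum]; exact Finset.sum_congr rfl fun x _ => by rw [hc x]
    have h2 : ∑ x, F x = (2 : ℝ) ^ N * (if c = true then (1 : ℝ) else 0) := by
      rw [Finset.sum_congr rfl fun x _ => hc x, Finset.sum_const, Finset.card_univ, BooleanCorner.card_cube_nat,
        nsmul_eq_mul]
      push_cast; ring
    rw [h1, h2]
    have hA : 0 ≤ lam * (2 : ℝ) ^ N * (∑ j, ∑ x : Fin N → Bool, (F (update x j true) - F (update x j false)) ^ 2) :=
      mul_nonneg (mul_nonneg hl.le (by positivity))
        (Finset.sum_nonneg fun j _ => Finset.sum_nonneg fun x _ => sq_nonneg _)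
    have hB : 0 ≤ (∑ j, (∑ x : Fin N → Bool,
        (if ρ j = none ∧ j ∈ (DecisionTree.leaf c : DecisionTree N).queries (fun k => (ρ k).getD (x k))
          then (1 : ℝ) else 0)) * S j) / lam :=
      div_nonneg (Finset.sum_nonneg fun j _ => mul_nonneg
        (Finset.sum_nonneg fun x _ => by split_ifs <;> norm_num) (hS j)) hl.le
    nlinarith [hA, hB]
  | query i t₀ t₁ ih₀ ih₁ =>
    intro ρ F g S lam hF hS hl hg
    -- notation for the weights and the sensitivity sum
    set W : Fin N → ℝ := fun j => ∑ x : Fin N → Bool,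
      (if ρ j = none ∧ j ∈ (DecisionTree.query i t₀ t₁).queries (fun k => (ρ k).getD (x k))
        then (1 : ℝ) else 0) with hW
    rcases hρ : ρ i with _ | b
    · /- fresh query: split along `x i` -/
      set ρ₀ : Fin N → Option Bool := update ρ i (some false) with hρ₀
      set ρ₁ : Fin N → Option Bool := update ρ i (some true) with hρ₁
      set F₀ : (Fin N → Bool) → ℝ :=
        fun x => if t₀.eval (fun k => (ρ₀ k).getD (x k)) = true then (1 : ℝ) else 0 with hF₀
      set F₁ : (Fin N → Bool) → ℝ :=
        fun x => if t₁.eval (fun k => (ρ₁ k).getD (x k)) = true then (1 : ℝ) else 0 with hF₁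
      set g₀ : (Fin N → Bool) → ℝ := fun x => g (update x i false) with hg₀
      set g₁ : (Fin N → Bool) → ℝ := fun x => g (update x i true) with hg₁
      set Γ : (Fin N → Bool) → ℝ := fun x => (g₀ x + g₁ x) / 2 with hΓ
      set W₀ : Fin N → ℝ := fun j => ∑ x : Fin N → Bool,
        (if ρ₀ j = none ∧ j ∈ t₀.queries (fun k => (ρ₀ k).getD (x k)) then (1 : ℝ) else 0) with hW₀
      set W₁ : Fin N → ℝ := fun j => ∑ x : Fin N → Bool,
        (if ρ₁ j = none ∧ j ∈ t₁.queries (fun k => (ρ₁ k).getD (x k)) then (1 : ℝ) else 0) with hW₁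
      -- sensitivity sums
      set A : ℝ := ∑ j, ∑ x : Fin N → Bool, (F (update x j true) - F (update x j false)) ^ 2 with hA
      set A₀ : ℝ := ∑ j, ∑ x : Fin N → Bool, (F₀ (update x j true) - F₀ (update x j false)) ^ 2 with hA₀
      set A₁ : ℝ := ∑ j, ∑ x : Fin N → Bool, (F₁ (update x j true) - F₁ (update x j false)) ^ 2 with hA₁
      -- overriding by `ρ[i ↦ b]` ignores `x i`
      have hov : ∀ (b c : Bool) (x : Fin N → Bool),
          (fun k => ((update ρ i (some b)) k).getD ((update x i c) k))
            = fun k => ((update ρ i (some b)) k).getD (x k) := by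
        intro b c x; funext k
        by_cases hk : k = i
        · subst hk; simp
        · simp [hk]
      have hF₀u : ∀ x c, F₀ (update x i c) = F₀ x := fun x c => by simp only [hF₀, hρ₀, hov]
      have hF₁u : ∀ x c, F₁ (update x i c) = F₁ x := fun x c => by simp only [hF₁, hρ₁, hov]
      have hg₀u : ∀ x c, g₀ (update x i c) = g₀ x := fun x c => by simp [hg₀]
      have hg₁u : ∀ x c, g₁ (update x i c) = g₁ x := fun x c => by simp [hg₁]
      -- on the branch `x i = b` the override by `ρ` is the override by `ρ[i ↦ b]`
      have hovb : ∀ (x : Fin N → Bool),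
          (fun k => (ρ k).getD (x k)) = fun k => ((update ρ i (some (x i))) k).getD (x k) := by
        intro x; funext k
        by_cases hk : k = i
        · subst hk; simp [hρ]
        · simp [hk]
      have hxi : ∀ x : Fin N → Bool, (ρ i).getD (x i) = x i := fun x => by simp [hρ]
      have hFx : ∀ x : Fin N → Bool, F x = if x i = true then F₁ x else F₀ x := by
        intro x
        rw [hF x, DecisionTree.eval_query]
        simp only [hxi x]
        rcases Bool.eq_false_or_eq_true (x i) with hx | hx
        · rw [if_pos hx, if_pos hx, hF₁, hρ₁]
          simp only
          rw [hovb x, hx]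
        · have hx' : ¬ (x i = true) := by rw [hx]; decide
          rw [if_neg hx', if_neg hx', hF₀, hρ₀]
          simp only
          rw [hovb x, hx]
      have hgs : ∀ x : Fin N → Bool, g x = if x i = true then g₁ x else g₀ x := by
        intro x
        rcases Bool.eq_false_or_eq_true (x i) with hx | hx
        · rw [if_pos hx, hg₁]; simp only; rw [← hx, update_eq_self]
        · have hx' : ¬ (x i = true) := by rw [hx]; decide
          rw [if_neg hx', hg₀]; simp only; rw [← hx, update_eq_self]
      -- the six sums
      have hSfg : ∑ x, F x * g x = ((∑ x, F₁ x * g₁ x) + ∑ x, F₀ x * g₀ x) / 2 := by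
        have : ∀ x, F x * g x = if x i = true then F₁ x * g₁ x else F₀ x * g₀ x := by
          intro x; rw [hFx x]
          rcases Bool.eq_false_or_eq_true (x i) with hx | hx
          · rw [if_pos hx, if_pos hx, hgs x, if_pos hx]
          · have hx' : ¬ (x i = true) := by rw [hx]; decide
            rw [if_neg hx', if_neg hx', hgs x, if_neg hx']
        rw [Finset.sum_congr rfl fun x _ => this x]
        exact BooleanCorner.sum_ite_update i _ _ (fun x c => by rw [hF₁u, hg₁u]) (fun x c => by rw [hF₀u, hg₀u])
      have hSf : ∑ x, F x = ((∑ x, F₁ x) + ∑ x, F₀ x) / 2 := by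
        rw [Finset.sum_congr rfl fun x _ => hFx x]
        exact BooleanCorner.sum_ite_update i _ _ hF₁u hF₀u
      have hSg : ∑ x, g x = ((∑ x, g₁ x) + ∑ x, g₀ x) / 2 := by
        conv_lhs => rw [Finset.sum_congr rfl fun x (_ : x ∈ Finset.univ) => hgs x]
        exact BooleanCorner.sum_ite_update i _ _ hg₁u hg₀u
      -- induction hypotheses on the sections, against `Γ`
      have hΓ_incr : ∀ j : Fin N, ∑ x, (Γ (update x j true) - Γ (update x j false)) ^ 2 ≤ S j := by
        intro j
        refine le_trans ?_ (hg j)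
        simp only [hΓ, hg₀, hg₁]
        exact sum_sq_sections_le i j g
      have IH₀ := ih₀ ρ₀ F₀ Γ S lam (fun x => rfl) hS hl hΓ_incr
      have IH₁ := ih₁ ρ₁ F₁ Γ S lam (fun x => rfl) hS hl hΓ_incr
      have hΓ₀ : ∑ x, F₀ x * Γ x = ((∑ x, F₀ x * g₀ x) + ∑ x, F₀ x * g₁ x) / 2 := by
        rw [← Finset.sum_add_distrib, Finset.sum_div]
        exact Finset.sum_congr rfl fun x _ => by simp only [hΓ]; ring
      have hΓ₁ : ∑ x, F₁ x * Γ x = ((∑ x, F₁ x * g₀ x) + ∑ x, F₁ x * g₁ x) / 2 := by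
        rw [← Finset.sum_add_distrib, Finset.sum_div]
        exact Finset.sum_congr rfl fun x _ => by simp only [hΓ]; ring
      have hΓs : ∑ x, Γ x = ((∑ x, g₀ x) + ∑ x, g₁ x) / 2 := by
        rw [← Finset.sum_add_distrib, Finset.sum_div]
      rw [hΓ₀, hΓs] at IH₀
      rw [hΓ₁, hΓs] at IH₁
      change (2 : ℝ) ^ N * (((∑ x, F₀ x * g₀ x) + ∑ x, F₀ x * g₁ x) / 2) -
          (∑ x, F₀ x) * (((∑ x, g₀ x) + ∑ x, g₁ x) / 2) ≤ (lam * (2 : ℝ) ^ N * A₀ + (∑ j, W₀ j * S j) / lam) / 8 at IH₀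
      change (2 : ℝ) ^ N * (((∑ x, F₁ x * g₀ x) + ∑ x, F₁ x * g₁ x) / 2) -
          (∑ x, F₁ x) * (((∑ x, g₀ x) + ∑ x, g₁ x) / 2) ≤ (lam * (2 : ℝ) ^ N * A₁ + (∑ j, W₁ j * S j) / lam) / 8 at IH₁
      -- the cross term `Σ (F₁ − F₀)(g₁ − g₀) ≤ (λ Σ (F₁−F₀)² + Σ (g₁−g₀)²/λ)/2 ≤ (λ Σ (F₁−F₀)² + Sᵢ/λ)/2`
      set Ai : ℝ := ∑ x : Fin N → Bool, (F₁ x - F₀ x) ^ 2 with hAi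
      set Sl : ℝ := S i / lam with hSl
      have hcross : (∑ x, F₁ x * g₁ x) - (∑ x, F₁ x * g₀ x) - (∑ x, F₀ x * g₁ x) + ∑ x, F₀ x * g₀ x ≤
          lam / 2 * Ai + Sl / 2 := by
        have h1 : (∑ x, F₁ x * g₁ x) - (∑ x, F₁ x * g₀ x) - (∑ x, F₀ x * g₁ x) + ∑ x, F₀ x * g₀ x
            = ∑ x, (F₁ x - F₀ x) * (g₁ x - g₀ x) := by
          rw [← Finset.sum_sub_distrib, ← Finset.sum_sub_distrib, ← Finset.sum_add_distrib]
          exact Finset.sum_congr rfl fun x _ => by ring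
        rw [h1]
        have h2 : ∑ x, (F₁ x - F₀ x) * (g₁ x - g₀ x) ≤
            ∑ x, (lam / 2 * (F₁ x - F₀ x) ^ 2 + (g₁ x - g₀ x) ^ 2 / (2 * lam)) :=
          Finset.sum_le_sum fun x _ => mul_le_of_pos hl (F₁ x - F₀ x) (g₁ x - g₀ x)
        refine h2.trans ?_
        have h3 : ∑ x, (lam / 2 * (F₁ x - F₀ x) ^ 2 + (g₁ x - g₀ x) ^ 2 / (2 * lam)) =
            lam / 2 * Ai + (∑ x, (g₁ x - g₀ x) ^ 2) / (2 * lam) := by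
          rw [Finset.sum_add_distrib, ← Finset.mul_sum, ← Finset.sum_div]
        rw [h3]
        have h4 : (∑ x, (g₁ x - g₀ x) ^ 2) ≤ S i := by simpa only [hg₁, hg₀] using hg i
        have h5 : (∑ x, (g₁ x - g₀ x) ^ 2) / (2 * lam) ≤ S i / (2 * lam) :=
          div_le_div_of_nonneg_right h4 (by positivity)
        have h6 : S i / (2 * lam) = Sl / 2 := by rw [hSl, div_div, mul_comm]
        linarith
      -- the sensitivity sums: `A = Ai + (A₀ + A₁)/2`
      have hAeq : A = Ai + (A₁ + A₀) / 2 := by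
        have hsplit : ∀ (Φ : Fin N → ℝ), ∑ j, Φ j = Φ i + ∑ j ∈ Finset.univ.erase i, Φ j := by
          intro Φ
          rw [← Finset.add_sum_erase Finset.univ Φ (Finset.mem_univ i)]
        -- `j = i` terms
        have hAii : ∑ x : Fin N → Bool, (F (update x i true) - F (update x i false)) ^ 2 = Ai := by
          refine Finset.sum_congr rfl fun x _ => ?_
          rw [hFx (update x i true), hFx (update x i false)]
          simp only [update_self, if_true, Bool.false_eq_true, if_false, hF₁u, hF₀u]
        have hA₀i : ∑ x : Fin N → Bool, (F₀ (update x i true) - F₀ (update x i false)) ^ 2 = 0 := by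
          refine Finset.sum_eq_zero fun x _ => ?_
          rw [hF₀u, hF₀u, sub_self]; ring
        have hA₁i : ∑ x : Fin N → Bool, (F₁ (update x i true) - F₁ (update x i false)) ^ 2 = 0 := by
          refine Finset.sum_eq_zero fun x _ => ?_
          rw [hF₁u, hF₁u, sub_self]; ring
        -- `j ≠ i` terms
        have hAj : ∀ j, j ≠ i → ∑ x : Fin N → Bool, (F (update x j true) - F (update x j false)) ^ 2 =
            ((∑ x : Fin N → Bool, (F₁ (update x j true) - F₁ (update x j false)) ^ 2) +
              ∑ x : Fin N → Bool, (F₀ (update x j true) - F₀ (update x j false)) ^ 2) / 2 := by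
          intro j hji
          have hcomm : ∀ (x : Fin N → Bool) (c b : Bool), update (update x i c) j b = update (update x j b) i c :=
            fun x c b => update_comm (Ne.symm hji) _ _ _
          have hpt : ∀ x : Fin N → Bool, (F (update x j true) - F (update x j false)) ^ 2 =
              if x i = true then (F₁ (update x j true) - F₁ (update x j false)) ^ 2
              else (F₀ (update x j true) - F₀ (update x j false)) ^ 2 := by
            intro x
            rw [hFx (update x j true), hFx (update x j false)]
            simp only [update_of_ne (Ne.symm hji)]
            split_ifs <;> rfl
          rw [Finset.sum_congr rfl fun x _ => hpt x]
          refine BooleanCorner.sum_ite_update i _ _ (fun x c => ?_) (fun x c => ?_)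
          · rw [hcomm, hcomm, hF₁u, hF₁u]
          · rw [hcomm, hcomm, hF₀u, hF₀u]
        rw [hA, hA₀, hA₁, hsplit, hsplit (fun j => ∑ x : Fin N → Bool, (F₁ (update x j true) - F₁ (update x j false)) ^ 2),
          hsplit (fun j => ∑ x : Fin N → Bool, (F₀ (update x j true) - F₀ (update x j false)) ^ 2),
          hAii, hA₀i, hA₁i]
        have hrest : ∑ j ∈ Finset.univ.erase i, ∑ x : Fin N → Bool, (F (update x j true) - F (update x j false)) ^ 2 =
            ((∑ j ∈ Finset.univ.erase i, ∑ x : Fin N → Bool, (F₁ (update x j true) - F₁ (update x j false)) ^ 2) +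
              ∑ j ∈ Finset.univ.erase i, ∑ x : Fin N → Bool, (F₀ (update x j true) - F₀ (update x j false)) ^ 2) / 2 := by
          rw [← Finset.sum_add_distrib, Finset.sum_div]
          refine Finset.sum_congr rfl fun j hj => ?_
          rw [hAj j (Finset.ne_of_mem_erase hj)]
        rw [hrest]
        ring
      -- the weights: `(W₀ j + W₁ j)/2 + [j = i]·2^N ≤ W j`
      have hWi : W i = (2 : ℝ) ^ N := by
        simp only [hW]
        have : ∀ x : Fin N → Bool, (if ρ i = none ∧ i ∈ (DecisionTree.query i t₀ t₁).queries
            (fun k => (ρ k).getD (x k)) then (1 : ℝ) else 0) = 1 := by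
          intro x
          rw [if_pos ⟨hρ, by rw [DecisionTree.queries_query]; exact Finset.mem_insert_self _ _⟩]
        rw [Finset.sum_congr rfl fun x _ => this x, Finset.sum_const, Finset.card_univ, BooleanCorner.card_cube_nat,
          nsmul_eq_mul, mul_one]
        push_cast; ring
      have hW₀i : W₀ i = 0 := by
        simp only [hW₀]
        refine Finset.sum_eq_zero fun x _ => ?_
        rw [if_neg]
        rintro ⟨h, -⟩
        rw [hρ₀, update_self] at h
        exact Option.some_ne_none _ h
      have hW₁i : W₁ i = 0 := by
        simp only [hW₁]
        refine Finset.sum_eq_zero fun x _ => ?_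
        rw [if_neg]
        rintro ⟨h, -⟩
        rw [hρ₁, update_self] at h
        exact Option.some_ne_none _ h
      have hWj : ∀ j, j ≠ i → W j = (W₁ j + W₀ j) / 2 := by
        intro j hji
        simp only [hW, hW₀, hW₁]
        have hρj₀ : ρ₀ j = ρ j := by rw [hρ₀, update_of_ne hji]
        have hρj₁ : ρ₁ j = ρ j := by rw [hρ₁, update_of_ne hji]
        have hpt : ∀ x : Fin N → Bool,
            (if ρ j = none ∧ j ∈ (DecisionTree.query i t₀ t₁).queries (fun k => (ρ k).getD (x k))
              then (1 : ℝ) else 0) =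
            if x i = true then
              (if ρ₁ j = none ∧ j ∈ t₁.queries (fun k => (ρ₁ k).getD (x k)) then (1 : ℝ) else 0)
            else
              (if ρ₀ j = none ∧ j ∈ t₀.queries (fun k => (ρ₀ k).getD (x k)) then (1 : ℝ) else 0) := by
          intro x
          have hq : (DecisionTree.query i t₀ t₁).queries (fun k => (ρ k).getD (x k)) =
              insert i (if x i = true then t₁.queries (fun k => (ρ k).getD (x k))
                else t₀.queries (fun k => (ρ k).getD (x k))) := by
            rw [DecisionTree.queries_query, hxi x]
          rcases Bool.eq_false_or_eq_true (x i) with hx | hx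
          · have hov' := hovb x
            rw [hx, ← hρ₁] at hov'
            have hmem : (ρ j = none ∧ j ∈ (DecisionTree.query i t₀ t₁).queries (fun k => (ρ k).getD (x k))) ↔
                (ρ₁ j = none ∧ j ∈ t₁.queries (fun k => (ρ₁ k).getD (x k))) := by
              rw [hq, hx, if_pos rfl, Finset.mem_insert, hρj₁, ← hov']
              simp only [hji, false_or]
            rw [if_pos hx]
            by_cases hc : (ρ₁ j = none ∧ j ∈ t₁.queries (fun k => (ρ₁ k).getD (x k)))
            · rw [if_pos hc, if_pos (hmem.mpr hc)]
            · rw [if_neg hc, if_neg (fun h => hc (hmem.mp h))]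
          · have hx' : ¬ (x i = true) := by rw [hx]; decide
            have hov' := hovb x
            rw [hx, ← hρ₀] at hov'
            have hmem : (ρ j = none ∧ j ∈ (DecisionTree.query i t₀ t₁).queries (fun k => (ρ k).getD (x k))) ↔
                (ρ₀ j = none ∧ j ∈ t₀.queries (fun k => (ρ₀ k).getD (x k))) := by
              rw [hq, hx, if_neg Bool.false_ne_true, Finset.mem_insert, hρj₀, ← hov']
              simp only [hji, false_or]
            rw [if_neg hx']
            by_cases hc : (ρ₀ j = none ∧ j ∈ t₀.queries (fun k => (ρ₀ k).getD (x k)))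
            · rw [if_pos hc, if_pos (hmem.mpr hc)]
            · rw [if_neg hc, if_neg (fun h => hc (hmem.mp h))]
        rw [Finset.sum_congr rfl fun x _ => hpt x]
        refine BooleanCorner.sum_ite_update i _ _ (fun x c => ?_) (fun x c => ?_)
        · simp only [hρ₁, hov]
        · simp only [hρ₀, hov]
      have hsum : (∑ j, W₀ j * S j) / 2 + (∑ j, W₁ j * S j) / 2 + (2 : ℝ) ^ N * S i ≤ ∑ j, W j * S j := by
        have hsplit : ∀ (V : Fin N → ℝ), ∑ j, V j * S j = V i * S i + ∑ j ∈ Finset.univ.erase i, V j * S j := by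
          intro V
          rw [← Finset.add_sum_erase Finset.univ (fun j => V j * S j) (Finset.mem_univ i)]
        rw [hsplit W₀, hsplit W₁, hsplit W, hW₀i, hW₁i, hWi]
        have hrest : ∑ j ∈ Finset.univ.erase i, W j * S j =
            (∑ j ∈ Finset.univ.erase i, W₀ j * S j) / 2 + (∑ j ∈ Finset.univ.erase i, W₁ j * S j) / 2 := by
          rw [Finset.sum_div, Finset.sum_div, ← Finset.sum_add_distrib]
          refine Finset.sum_congr rfl fun j hj => ?_
          rw [hWj j (Finset.ne_of_mem_erase hj)]
          ring
        rw [hrest]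
        nlinarith
      -- divide `hsum` by `λ > 0` and combine
      set B₀ : ℝ := (∑ j, W₀ j * S j) / lam with hB₀
      set B₁ : ℝ := (∑ j, W₁ j * S j) / lam with hB₁
      set B : ℝ := (∑ j, W j * S j) / lam with hB
      have hsum' : B₀ / 2 + B₁ / 2 + (2 : ℝ) ^ N * Sl ≤ B := by
        have := div_le_div_of_nonneg_right hsum hl.le
        have he : ((∑ j, W₀ j * S j) / 2 + (∑ j, W₁ j * S j) / 2 + (2 : ℝ) ^ N * S i) / lam =
            B₀ / 2 + B₁ / 2 + (2 : ℝ) ^ N * Sl := by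
          rw [hB₀, hB₁, hSl]
          field_simp
        rw [he] at this
        exact this
      rw [hSfg, hSf, hSg]
      change _ ≤ (lam * (2 : ℝ) ^ N * A + B) / 8
      rw [hAeq]
      have h2N : (0 : ℝ) ≤ (2 : ℝ) ^ N := by positivity
      have hcross' : (2 : ℝ) ^ N * ((∑ x, F₁ x * g₁ x) - (∑ x, F₁ x * g₀ x) - (∑ x, F₀ x * g₁ x) + ∑ x, F₀ x * g₀ x) ≤
          (2 : ℝ) ^ N * (lam / 2 * Ai + Sl / 2) := mul_le_mul_of_nonneg_left hcross h2N
      nlinarith [IH₀, IH₁, hcross', hsum']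
    · /- the root variable is already assigned by `ρ`: the tree behaves as the `b`-subtree, weights only grow -/
      have hxi : ∀ x : Fin N → Bool, (ρ i).getD (x i) = b := fun x => by simp [hρ]
      have hmono : ∀ (t : DecisionTree N),
          (∀ x : Fin N → Bool, t.queries (fun k => (ρ k).getD (x k)) ⊆
            (DecisionTree.query i t₀ t₁).queries (fun k => (ρ k).getD (x k))) →
          (lam * (2 : ℝ) ^ N * (∑ j, ∑ x : Fin N → Bool, (F (update x j true) - F (update x j false)) ^ 2) +
            (∑ j, (∑ x : Fin N → Bool,
              (if ρ j = none ∧ j ∈ t.queries (fun k => (ρ k).getD (x k)) then (1 : ℝ) else 0)) * S j) / lam) / 8 ≤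
          (lam * (2 : ℝ) ^ N * (∑ j, ∑ x : Fin N → Bool, (F (update x j true) - F (update x j false)) ^ 2) +
            (∑ j, W j * S j) / lam) / 8 := by
        intro t hsub
        have hle : ∑ j, (∑ x : Fin N → Bool,
              (if ρ j = none ∧ j ∈ t.queries (fun k => (ρ k).getD (x k)) then (1 : ℝ) else 0)) * S j ≤
            ∑ j, W j * S j := by
          refine Finset.sum_le_sum fun j _ => ?_
          refine mul_le_mul_of_nonneg_right (Finset.sum_le_sum fun x _ => ?_) (hS j)
          split_ifs with h1 h2
          · exact le_rfl
          · exact absurd ⟨h1.1, hsub x h1.2⟩ h2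
          · norm_num
          · exact le_rfl
        have := div_le_div_of_nonneg_right hle hl.le
        linarith
      cases b with
      | false =>
        have hF' : ∀ x, F x = if t₀.eval (fun k => (ρ k).getD (x k)) = true then (1 : ℝ) else 0 := by
          intro x; rw [hF x, DecisionTree.eval_query]; simp only [hxi x]; rfl
        refine (ih₀ ρ F g S lam hF' hS hl hg).trans (hmono t₀ fun x => ?_)
        rw [DecisionTree.queries_query, hxi x]
        exact Finset.subset_insert _ _
      | true =>
        have hF' : ∀ x, F x = if t₁.eval (fun k => (ρ k).getD (x k)) = true then (1 : ℝ) else 0 := by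
          intro x; rw [hF x, DecisionTree.eval_query]; simp only [hxi x]; rfl
        refine (ih₁ ρ F g S lam hF' hS hl hg).trans (hmono t₁ fun x => ?_)
        rw [DecisionTree.queries_query, hxi x]
        exact Finset.subset_insert _ _

end ClassicalCornerSensitivityOSSS

end Summit.QuantumAdvantage.QuantumAdvantage.Theorems.SosSandwich

end
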